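import Summits.CriticalPhenomena.PercolationContinuityZ3.Theorems.FK.InfiniteVolumeMeasures
import HarnessLib

/-!
# FK-continuity transplant, FO-06 (construction half): finite-volume bounds for the infinite-volume
# random-cluster measures — `φ⁰_{Λ_n} ≤ φ⁰ ≤ φ¹ ≤ φ¹_{Λ_n}` on increasing events

Cell `fk-continuity` (bschramm), row FO-06 seat B; support file for the FK-continuity transplant
(`--supports stmt-CriticalPhenomena-4575`); builds on p205010 (kernel theorem, internal audit signed;
external expert review pending). No named facts, no sorries, standard axioms. General dimension `d`.

Grimmett 2006, proof of Thm. (4.19)(a)–(b) (eq. (4.24) and the first display on p. 78: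
`φ⁰_{p,q}(B) ≥ φ⁰_{Λ,p,q}(B)` for increasing cylinders `B`, dually for `φ¹`), for the box laws
`rcBoxLaw d b p q n` and box limits `IsBoxLimit d b p q P` of `InfiniteVolumeDefs.lean`, and for
GENERAL increasing events (not only the "all of `E₀` open" cylinders of `InfiniteVolumeBoxLaws.lean`):

* `liftEdges_finsetRestrict` — restricting a configuration of `Λ_n` to `Λ_m ⊆ Λ_n` and reading it on
  `ℤ^d` keeps exactly the open pairs inside `Λ_m`;
* `rcBoxLaw_false_real_mono` — **free box laws increase with the box on every increasing event**
  (no locality needed); `rcBoxLaw_true_real_anti_of_determinedBy` — **wired box laws decrease with the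
  box on increasing events determined inside the smaller box** (`d ≥ 1`);
* `IsBoxLimit.rcBoxLaw_real_le` — `φ⁰_{Λ_n,p,q}(A) ≤ φ⁰_{p,q}(A)` for increasing local `A`, every `n`;
  `IsBoxLimit.real_le_rcBoxLaw` — `φ¹_{p,q}(A) ≤ φ¹_{Λ_n,p,q}(A)` for increasing `A` determined inside
  `Λ_n`; the decreasing duals `IsBoxLimit.real_le_rcBoxLaw_of_isLowerSet`,
  `IsBoxLimit.rcBoxLaw_real_le_of_isLowerSet`; and the `rcLimit` forms.

These are the finite-volume handles on `φ^b_{p,q}` used downstream (FO-07: `θ¹(p,q) ≤ φ¹_{Λ_n}(0 ↔ ∂Λ_n)`;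
FO-10/11: worst-case boundary-condition bounds).

## References

* G. Grimmett, *The Random-Cluster Model*, Springer 2006: Lemma (4.13), Thm. (4.19)(a)–(b) and proof,
  eq. (4.24), p. 78. [Grimmett2006]
-/

noncomputable section

open MeasureTheory Set Filter
open scoped Topology ENNReal

namespace Summit.CriticalPhenomena.PercolationContinuityZ3.Theorems.FK

open Literature.Probability.Percolation Literature.Probability.LatticeModels

variable {d : ℕ}

/-! ### Restriction of box configurations, read on `ℤ^d` -/

/-- Restricting a configuration of `Λ_n` to `Λ_m ⊆ Λ_n` and reading it on `ℤ^d` keeps exactly the open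
pairs with both endpoints in `Λ_m`. [cite: Grimmett2006, §4.2 (configurations on E_Λ)] -/
theorem liftEdges_finsetRestrict {m n : ℕ} (hmn : m ≤ n) (ω : BondConfig ↥(box d n)) :
    liftEdges (box d m) (finsetRestrict (box_mono d hmn) ω) =
      liftEdges (box d n) ω ∩ {e | ∀ z ∈ e, z ∈ box d m} := by
  ext e
  simp only [mem_liftEdges_iff, mem_finsetRestrict_iff, Set.mem_inter_iff, Set.mem_setOf_eq]
  constructor
  · rintro ⟨e', he', rfl⟩
    induction e' using Sym2.ind with
    | h u v =>
      refine ⟨⟨edgeLift (box_mono d hmn) s(u, v), he', ?_⟩, ?_⟩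
      · rw [edgeLift_mk, Sym2.map_mk, Sym2.map_mk]
        rfl
      · intro z hz
        rw [Sym2.map_mk, Sym2.mem_iff] at hz
        rcases hz with rfl | rfl
        · exact u.2
        · exact v.2
  · rintro ⟨⟨e'', he'', rfl⟩, hin⟩
    induction e'' using Sym2.ind with
    | h u v =>
      have hu : u.1 ∈ box d m := hin u.1 (by rw [Sym2.map_mk]; exact Sym2.mem_mk_left _ _)
      have hv : v.1 ∈ box d m := hin v.1 (by rw [Sym2.map_mk]; exact Sym2.mem_mk_right _ _)
      refine ⟨s(⟨u.1, hu⟩, ⟨v.1, hv⟩), ?_, by rw [Sym2.map_mk, Sym2.map_mk]⟩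
      have : edgeLift (box_mono d hmn) s(⟨u.1, hu⟩, ⟨v.1, hv⟩) = s(u, v) := by
        rw [edgeLift_mk]
        rfl
      show edgeLift (box_mono d hmn) s(⟨u.1, hu⟩, ⟨v.1, hv⟩) ∈ ω
      rw [this]
      exact he''

/-- In particular the restricted-and-lifted configuration is a sub-configuration of the lifted one.
[folklore] -/
theorem liftEdges_finsetRestrict_subset {m n : ℕ} (hmn : m ≤ n) (ω : BondConfig ↥(box d n)) :
    liftEdges (box d m) (finsetRestrict (box_mono d hmn) ω) ⊆ liftEdges (box d n) ω := by
  rw [liftEdges_finsetRestrict hmn]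
  exact Set.inter_subset_left

/-- For an event determined by pairs inside `Λ_m`, pulling back to `Λ_m` and then along the
restriction `Λ_n → Λ_m` is pulling back to `Λ_n`. [cite: Grimmett2006, §4.2 (cylinder events of E_Λ)] -/
theorem finsetRestrict_preimage_liftEdges_preimage {A : Set (BondConfig (Site d))}
    {F : Finset (Sym2 (Site d))} (hA : DeterminedBy A ↑F) {m n : ℕ}
    (hF : ∀ e ∈ F, ∀ z ∈ e, z ∈ box d m) (hmn : m ≤ n) :
    finsetRestrict (box_mono d hmn) ⁻¹' (liftEdges (box d m) ⁻¹' A) = liftEdges (box d n) ⁻¹' A := by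
  ext ω
  simp only [Set.mem_preimage, liftEdges_finsetRestrict hmn]
  refine (determinedBy_iff _ _).1 hA _ _ ?_
  ext e
  simp only [Set.mem_inter_iff, Set.mem_setOf_eq, Finset.mem_coe]
  constructor
  · rintro ⟨⟨he, -⟩, heF⟩
    exact ⟨he, heF⟩
  · rintro ⟨he, heF⟩
    exact ⟨⟨he, hF e heF⟩, heF⟩

/-! ### Monotonicity of the box laws in the box, general increasing events -/

/-- **The free box laws increase with the box on every increasing event** (Grimmett's (4.24) with
`b = 0`; no locality is needed: the restriction to the smaller box lifts to a sub-configuration).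
[cite: Grimmett2006, Thm. (4.19)(a), proof, eq. (4.24)] -/
theorem rcBoxLaw_false_real_mono {p q : ℝ} (hp : p ∈ Set.Icc (0 : ℝ) 1) (hq : 1 ≤ q)
    {A : Set (BondConfig (Site d))} (hA : IsUpperSet A) (hAm : MeasurableSet A) {m n : ℕ}
    (hmn : m ≤ n) : (rcBoxLaw d false p q m).real A ≤ (rcBoxLaw d false p q n).real A := by
  haveI := isProbabilityMeasure_rcBoxMeasure false hp (one_pos.trans_le hq) n (d := d)
  rw [rcBoxLaw_real_apply _ _ _ _ hAm, rcBoxLaw_real_apply _ _ _ _ hAm]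
  calc (rcBoxMeasure d false p q m).real (liftEdges (box d m) ⁻¹' A)
      ≤ (rcBoxMeasure d false p q n).real
          (finsetRestrict (box_mono d hmn) ⁻¹' (liftEdges (box d m) ⁻¹' A)) :=
        rcMeasure_real_box_free_le_restrict hmn hp hq (hA.preimage (liftEdges_mono _))
    _ ≤ (rcBoxMeasure d false p q n).real (liftEdges (box d n) ⁻¹' A) :=
        measureReal_mono (fun ω hω => hA (liftEdges_finsetRestrict_subset hmn ω) hω)
          (measure_ne_top _ _)

/-- **The wired box laws decrease with the box on increasing events determined inside the smaller
box** ((4.24) reversed for `b = 1`; `d ≥ 1`). [cite: Grimmett2006, Thm. (4.19)(a), proof, eq. (4.24)] -/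
theorem rcBoxLaw_true_real_anti_of_determinedBy (hd : 0 < d) {p q : ℝ} (hp : p ∈ Set.Icc (0 : ℝ) 1)
    (hq : 1 ≤ q) {A : Set (BondConfig (Site d))} {F : Finset (Sym2 (Site d))} (hA : DeterminedBy A ↑F)
    (hAu : IsUpperSet A) {m n : ℕ} (hF : ∀ e ∈ F, ∀ z ∈ e, z ∈ box d m) (hmn : m ≤ n) :
    (rcBoxLaw d true p q n).real A ≤ (rcBoxLaw d true p q m).real A := by
  have hAm : MeasurableSet A := measurableSet_of_isLocalEvent_holds ⟨F, hA⟩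
  rw [rcBoxLaw_real_apply _ _ _ _ hAm, rcBoxLaw_real_apply _ _ _ _ hAm, rcBoxMeasure_true,
    rcBoxMeasure_true, ← finsetRestrict_preimage_liftEdges_preimage hA hF hmn]
  exact rcMeasure_real_box_restrict_le hd hmn hp hq (hAu.preimage (liftEdges_mono _))

/-- The free box laws also agree, along the restriction, on events determined inside the smaller
box; combined with (4.24): `φ⁰_{Λ_m}(A) ≤ φ⁰_{Λ_n}(A)` (special case of `rcBoxLaw_false_real_mono`,
recorded for symmetry). [cite: Grimmett2006, Thm. (4.19)(a), proof, eq. (4.24)] -/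
theorem rcBoxLaw_false_real_mono_of_determinedBy {p q : ℝ} (hp : p ∈ Set.Icc (0 : ℝ) 1)
    (hq : 1 ≤ q) {A : Set (BondConfig (Site d))} {F : Finset (Sym2 (Site d))} (hA : DeterminedBy A ↑F)
    (hAu : IsUpperSet A) {m n : ℕ} (hmn : m ≤ n) :
    (rcBoxLaw d false p q m).real A ≤ (rcBoxLaw d false p q n).real A :=
  rcBoxLaw_false_real_mono hp hq hAu (measurableSet_of_isLocalEvent_holds ⟨F, hA⟩) hmn

/-! ### Finite-volume bounds for the box limits -/

section Limit

variable {p q : ℝ} {P : Measure (BondConfig (Site d))}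

/-- **`φ⁰_{Λ_n,p,q}(A) ≤ φ⁰_{p,q}(A)` for every increasing local event and every box** — the first
display of Grimmett's proof of Thm. (4.19)(b): the free box probabilities increase to their limit.
[cite: Grimmett2006, Thm. (4.19)(b), proof (p. 78)] -/
theorem IsBoxLimit.rcBoxLaw_real_le (hP : IsBoxLimit d false p q P) (hp : p ∈ Set.Icc (0 : ℝ) 1)
    (hq : 1 ≤ q) {A : Set (BondConfig (Site d))} (hA : IsLocalEvent A) (hAu : IsUpperSet A) (n : ℕ) :
    (rcBoxLaw d false p q n).real A ≤ P.real A :=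
  Monotone.ge_of_tendsto
    (fun _ _ hmn => rcBoxLaw_false_real_mono hp hq hAu (measurableSet_of_isLocalEvent_holds hA) hmn)
    (hP.tendsto_real hA) n

/-- **`φ¹_{p,q}(A) ≤ φ¹_{Λ_n,p,q}(A)` for every increasing event determined inside `Λ_n`** (`d ≥ 1`):
the wired box probabilities decrease to their limit. [cite: Grimmett2006, Thm. (4.19)(b), proof (p. 78)] -/
theorem IsBoxLimit.real_le_rcBoxLaw (hP : IsBoxLimit d true p q P) (hd : 0 < d)
    (hp : p ∈ Set.Icc (0 : ℝ) 1) (hq : 1 ≤ q) {A : Set (BondConfig (Site d))}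
    {F : Finset (Sym2 (Site d))} (hA : DeterminedBy A ↑F) (hAu : IsUpperSet A) {n : ℕ}
    (hF : ∀ e ∈ F, ∀ z ∈ e, z ∈ box d n) : P.real A ≤ (rcBoxLaw d true p q n).real A := by
  -- the shifted sequence `k ↦ φ¹_{Λ_{n+k}}(A)` is antitone and tends to `P(A)`
  have hanti : Antitone fun k : ℕ => (rcBoxLaw d true p q (n + k)).real A := fun k l hkl =>
    rcBoxLaw_true_real_anti_of_determinedBy hd hp hq hA hAu
      (fun e he z hz => box_mono d (Nat.le_add_right n k) (hF e he z hz)) (by omega)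
  have hlim : Tendsto (fun k : ℕ => (rcBoxLaw d true p q (n + k)).real A) atTop (𝓝 (P.real A)) :=
    (hP.tendsto_real ⟨F, hA⟩).comp (tendsto_add_atTop_nat n |>.congr fun k => by ring_nf)
  simpa using hanti.le_of_tendsto hlim 0

/-- Dually, **`φ⁰_{p,q}(A) ≤ φ⁰_{Λ_n,p,q}(A)` for every decreasing local event** (complement of an
increasing local event). [cite: Grimmett2006, Thm. (4.19)(b), proof (p. 78)] -/
theorem IsBoxLimit.real_le_rcBoxLaw_of_isLowerSet (hP : IsBoxLimit d false p q P)
    (hp : p ∈ Set.Icc (0 : ℝ) 1) (hq : 1 ≤ q) {A : Set (BondConfig (Site d))} (hA : IsLocalEvent A)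
    (hAl : IsLowerSet A) (n : ℕ) : P.real A ≤ (rcBoxLaw d false p q n).real A := by
  haveI := hP.isProbabilityMeasure
  haveI := isProbabilityMeasure_rcBoxLaw false hp (one_pos.trans_le hq) n (d := d)
  have hAm : MeasurableSet A := measurableSet_of_isLocalEvent_holds hA
  have h := hP.rcBoxLaw_real_le hp hq hA.compl hAl.compl n
  rw [probReal_compl_eq_one_sub hAm, probReal_compl_eq_one_sub hAm] at h
  linarith

/-- Dually, **`φ¹_{Λ_n,p,q}(A) ≤ φ¹_{p,q}(A)` for every decreasing event determined inside `Λ_n`**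
(`d ≥ 1`). [cite: Grimmett2006, Thm. (4.19)(b), proof (p. 78)] -/
theorem IsBoxLimit.rcBoxLaw_real_le_of_isLowerSet (hP : IsBoxLimit d true p q P) (hd : 0 < d)
    (hp : p ∈ Set.Icc (0 : ℝ) 1) (hq : 1 ≤ q) {A : Set (BondConfig (Site d))}
    {F : Finset (Sym2 (Site d))} (hA : DeterminedBy A ↑F) (hAl : IsLowerSet A) {n : ℕ}
    (hF : ∀ e ∈ F, ∀ z ∈ e, z ∈ box d n) : (rcBoxLaw d true p q n).real A ≤ P.real A := by
  haveI := hP.isProbabilityMeasure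
  haveI := isProbabilityMeasure_rcBoxLaw true hp (one_pos.trans_le hq) n (d := d)
  have hAm : MeasurableSet A := measurableSet_of_isLocalEvent_holds ⟨F, hA⟩
  have hAc : DeterminedBy Aᶜ ↑F := by
    rw [determinedBy_iff] at hA ⊢
    intro ω ω' h
    simp only [Set.mem_compl_iff, hA ω ω' h]
  have h := hP.real_le_rcBoxLaw hd hp hq hAc hAl.compl hF
  rw [probReal_compl_eq_one_sub hAm, probReal_compl_eq_one_sub hAm] at h
  linarith

/-- `φ⁰_{Λ_n,p,q}(A) ≤ (rcLimit d false p q)(A)` for increasing local `A`. [cite: Grimmett2006, Thm. (4.19)(b), proof] -/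
theorem rcBoxLaw_real_le_rcLimit {p q : ℝ} (hp : p ∈ Set.Icc (0 : ℝ) 1) (hq : 1 ≤ q)
    {A : Set (BondConfig (Site d))} (hA : IsLocalEvent A) (hAu : IsUpperSet A) (n : ℕ) :
    (rcBoxLaw d false p q n).real A ≤ (rcLimit d false p q).real A :=
  (isBoxLimit_rcLimit false hp hq).rcBoxLaw_real_le hp hq hA hAu n

/-- `(rcLimit d true p q)(A) ≤ φ¹_{Λ_n,p,q}(A)` for increasing `A` determined inside `Λ_n` (`d ≥ 1`).
[cite: Grimmett2006, Thm. (4.19)(b), proof] -/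
theorem rcLimit_real_le_rcBoxLaw (hd : 0 < d) {p q : ℝ} (hp : p ∈ Set.Icc (0 : ℝ) 1) (hq : 1 ≤ q)
    {A : Set (BondConfig (Site d))} {F : Finset (Sym2 (Site d))} (hA : DeterminedBy A ↑F)
    (hAu : IsUpperSet A) {n : ℕ} (hF : ∀ e ∈ F, ∀ z ∈ e, z ∈ box d n) :
    (rcLimit d true p q).real A ≤ (rcBoxLaw d true p q n).real A :=
  (isBoxLimit_rcLimit true hp hq).real_le_rcBoxLaw hd hp hq hA hAu hF

end Limit

end Summit.CriticalPhenomena.PercolationContinuityZ3.Theorems.FK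

end
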